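import Summits.QuantumFields.BalabanUV.Beta.FP.GradedIteratedDeriv

/-!
# `BalabanUV.Beta.FP.GradedIteratedDerivOn` — road «FP» for binder row D1, leaf H2-P, row H2-P-REG (owner ruling R-FP-17), PART 1′: the LOCAL form of the
# graded-derivative toolkit of `FP/GradedIteratedDeriv` — regularity is asked only as `ContDiffOn ℝ 3 f U` on an OPEN set `U ∋ x` (the continuum (1.66)
# multiplier's real slices are smooth on the open interval `|t| < π + δ₀` of W166-HOLO (D), not on all of `ℝ`)

HONEST DEPENDENCY (page 1, mandatory): continuum YM on T⁴ ⇐ BetaPertH ∧ nine spine estimates (0/9 proved); BetaPertH ⇐ (D1) ∧ (D4) ∧ CAP+tail;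
G-an2-4 gates asym, D1 and NE2/3/4.  HONEST FRAMING (cell contract, verbatim): «discharging `BetaPertH` makes Bałaban's UV stability UNCONDITIONAL —
a real constructive-QFT result; it is NOT the continuum limit and NOT the Clay problem.»  THIS MODULE DISCHARGES NOTHING of the wall: [folklore] one-variable
calculus over Mathlib (`norm_iteratedFDerivWithin_mul_le`, `iteratedFDerivWithin_of_isOpen`, `iteratedDerivWithin_of_isOpen`, `ContDiffOn.contDiffAt`,
`iteratedDeriv_add`, `iteratedDeriv_const_mul`, `ContDiffOn.differentiableOn_iteratedDerivWithin`).  0 def; no `def … : Prop`; nothing cited; 0 sorry;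
NOT D1, NOT BetaPertH, NOT continuum, NOT Clay.

ABSOLUTE RULE (cell charter, verbatim): «No internally-minted statement may enter as a cited fact. Every hypothesis is either kernel-proved in this package or a
verbatim quotation of a PUBLISHED theorem with page reference. The manuscript(s) under audit are NOT citable for their own disputed steps — they are the thing
under adjudication; programme-internal (2001/route/tribunal) claims are never citable.»

WHY.  `FP/GradedIteratedDeriv` (p234468) asks `ContDiff ℝ 3` on all of `ℝ`; the slices `t ↦ W166Inf μ ν (update p i t)` of the Lean closed form are smooth on
the open interval `(−(π+δ₀), π+δ₀)` only (W166-HOLO (D), d1-formalise-leaf-01 g8: outside it the unpatched removable singularities of `uInf l`, `l ≠ 0`, at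
`z = −2πl` make the Lean function discontinuous).  «Graded `(m, C)` at `x`» = the DISPLAYED hypothesis `∀ n ≤ 3, ‖iteratedDeriv n f x‖ ≤ C·ρ^{m−n}`.

WHAT (all with `hU : IsOpen U`, `hx : x ∈ U`).
* §1 `norm_iteratedDeriv_mul_le_on` (Leibniz bound from `ContDiffOn ℝ 3 · U`), **`graded_mul_on`** (orders add: `(m,C)·(m′,C′) ↦ (m+m′, 8·M^{m+m′}·C·C′)`),
  `graded_add_on`, `graded_const_mul_on`, `graded_sum_on`.
* §2 **`hasDerivAt_iteratedDeriv_on`**: `ContDiffOn ℝ 3 f U`, `t ∈ U`, `j < 3` ⟹ `HasDerivAt (iteratedDeriv j f) (iteratedDeriv (j+1) f t) t` — the `hder`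
  links of `PuncturedCoordDeriv` ∕ the `A_j` links of H2-P-INV from LOCAL regularity.
Provenance: binder row G-an2-4 owner lineage gan24-p3, gen 16 (prover-b2b-balaban-gan24-p3-g16-0), 2026-08-20; supplier of road FP's H2-P-REG (owner
b2b-balaban-beta-d1-p3, R-FP-17).
-/

noncomputable section

namespace Summit.QuantumFields.BalabanUV.Beta.FP.GradedIteratedDerivOn

open Complex
open scoped BigOperators Topology
open Summit.QuantumFields.BalabanUV.Beta.FP.GradedIteratedDeriv (pow_le_pow_mul_pow sum_choose_le_eight)

/-! ## §1 The local Leibniz bound and the local graded algebra -/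

/-- [folklore] the Leibniz BOUND at a point of an open set from `ContDiffOn ℝ 3` (Mathlib `norm_iteratedFDerivWithin_mul_le` on `U`, then
`iteratedFDerivWithin = iteratedFDeriv` on the open `U`). -/
theorem norm_iteratedDeriv_mul_le_on {U : Set ℝ} (hU : IsOpen U) {x : ℝ} (hx : x ∈ U) {f g : ℝ → ℂ} (hf : ContDiffOn ℝ 3 f U) (hg : ContDiffOn ℝ 3 g U)
    {n : ℕ} (hn : n ≤ 3) :
    ‖iteratedDeriv n (fun y => f y * g y) x‖
      ≤ ∑ i ∈ Finset.range (n + 1), (n.choose i : ℝ) * ‖iteratedDeriv i f x‖ * ‖iteratedDeriv (n - i) g x‖ := by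
  have h := norm_iteratedFDerivWithin_mul_le (𝕜 := ℝ) (N := 3) hf hg hU.uniqueDiffOn hx (n := n) (by exact_mod_cast hn)
  rw [iteratedFDerivWithin_of_isOpen n hU hx, norm_iteratedFDeriv_eq_norm_iteratedDeriv] at h
  refine h.trans (le_of_eq (Finset.sum_congr rfl fun i _ => ?_))
  rw [iteratedFDerivWithin_of_isOpen i hU hx, iteratedFDerivWithin_of_isOpen (n - i) hU hx, norm_iteratedFDeriv_eq_norm_iteratedDeriv,
    norm_iteratedFDeriv_eq_norm_iteratedDeriv]

/-- [folklore] **LOCAL PRODUCT RULE FOR GRADED BOUNDS**: graded `(m, C)` and `(m′, C′)` at `x ∈ U` (open), both `ContDiffOn ℝ 3 · U`, `0 ≤ C, C′`,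
`0 ≤ ρ ≤ M`, `1 ≤ M` ⟹ the product is graded `(m + m′, 8·M^{m+m′}·C·C′)` at `x`. -/
theorem graded_mul_on {U : Set ℝ} (hU : IsOpen U) {x : ℝ} (hx : x ∈ U) {m m' : ℕ} {C C' ρ M : ℝ} {f g : ℝ → ℂ}
    (hf : ContDiffOn ℝ 3 f U) (hg : ContDiffOn ℝ 3 g U) (hC : 0 ≤ C) (hC' : 0 ≤ C')
    (hF : ∀ n ≤ 3, ‖iteratedDeriv n f x‖ ≤ C * ρ ^ (m - n)) (hG : ∀ n ≤ 3, ‖iteratedDeriv n g x‖ ≤ C' * ρ ^ (m' - n))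
    (hρ : 0 ≤ ρ) (hρM : ρ ≤ M) (hM : 1 ≤ M) :
    ∀ n ≤ 3, ‖iteratedDeriv n (fun y => f y * g y) x‖ ≤ 8 * M ^ (m + m') * C * C' * ρ ^ (m + m' - n) := by
  intro n hn
  have hM0 : 0 ≤ M := zero_le_one.trans hM
  have hterm : ∀ i ∈ Finset.range (n + 1),
      (n.choose i : ℝ) * ‖iteratedDeriv i f x‖ * ‖iteratedDeriv (n - i) g x‖ ≤ (n.choose i : ℝ) * (M ^ (m + m') * C * C' * ρ ^ (m + m' - n)) := by
    intro i hi
    have hi' : i ≤ n := Nat.lt_succ_iff.mp (Finset.mem_range.mp hi)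
    have h1 := hF i (hi'.trans hn)
    have h2 := hG (n - i) ((Nat.sub_le n i).trans hn)
    have hpow : ρ ^ (m - i) * ρ ^ (m' - (n - i)) ≤ M ^ (m + m') * ρ ^ (m + m' - n) := by
      rw [← pow_add]
      exact pow_le_pow_mul_pow hρ hρM hM (by omega) (by omega)
    rw [mul_assoc]
    refine mul_le_mul_of_nonneg_left ?_ (Nat.cast_nonneg _)
    calc ‖iteratedDeriv i f x‖ * ‖iteratedDeriv (n - i) g x‖ ≤ (C * ρ ^ (m - i)) * (C' * ρ ^ (m' - (n - i))) :=
          mul_le_mul h1 h2 (norm_nonneg _) ((norm_nonneg _).trans h1)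
      _ = C * C' * (ρ ^ (m - i) * ρ ^ (m' - (n - i))) := by ring
      _ ≤ C * C' * (M ^ (m + m') * ρ ^ (m + m' - n)) := mul_le_mul_of_nonneg_left hpow (mul_nonneg hC hC')
      _ = M ^ (m + m') * C * C' * ρ ^ (m + m' - n) := by ring
  calc ‖iteratedDeriv n (fun y => f y * g y) x‖
      ≤ ∑ i ∈ Finset.range (n + 1), (n.choose i : ℝ) * ‖iteratedDeriv i f x‖ * ‖iteratedDeriv (n - i) g x‖ :=
        norm_iteratedDeriv_mul_le_on hU hx hf hg hn
    _ ≤ ∑ i ∈ Finset.range (n + 1), (n.choose i : ℝ) * (M ^ (m + m') * C * C' * ρ ^ (m + m' - n)) := Finset.sum_le_sum hterm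
    _ = (∑ i ∈ Finset.range (n + 1), (n.choose i : ℝ)) * (M ^ (m + m') * C * C' * ρ ^ (m + m' - n)) := by rw [Finset.sum_mul]
    _ ≤ 8 * (M ^ (m + m') * C * C' * ρ ^ (m + m' - n)) :=
        mul_le_mul_of_nonneg_right (sum_choose_le_eight hn) (by positivity)
    _ = 8 * M ^ (m + m') * C * C' * ρ ^ (m + m' - n) := by ring

/-- [folklore] `ContDiffOn ℝ 3` on an open `U ∋ x` gives `ContDiffAt ℝ n` at `x` for `n ≤ 3`. -/
theorem contDiffAt_of_on {U : Set ℝ} (hU : IsOpen U) {x : ℝ} (hx : x ∈ U) {f : ℝ → ℂ} (hf : ContDiffOn ℝ 3 f U) {n : ℕ} (hn : n ≤ 3) :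
    ContDiffAt ℝ (n : WithTop ℕ∞) f x :=
  ((hf.of_le (by exact_mod_cast hn)).contDiffAt (hU.mem_nhds hx))

/-- [folklore] **LOCAL SUM RULE**: graded `(m, C)` + graded `(m, C′)` ⟹ graded `(m, C + C′)` (both `ContDiffOn ℝ 3 · U`, `x ∈ U` open). -/
theorem graded_add_on {U : Set ℝ} (hU : IsOpen U) {x : ℝ} (hx : x ∈ U) {m : ℕ} {C C' ρ : ℝ} {f g : ℝ → ℂ}
    (hf : ContDiffOn ℝ 3 f U) (hg : ContDiffOn ℝ 3 g U)
    (hF : ∀ n ≤ 3, ‖iteratedDeriv n f x‖ ≤ C * ρ ^ (m - n)) (hG : ∀ n ≤ 3, ‖iteratedDeriv n g x‖ ≤ C' * ρ ^ (m - n)) :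
    ∀ n ≤ 3, ‖iteratedDeriv n (fun y => f y + g y) x‖ ≤ (C + C') * ρ ^ (m - n) := by
  intro n hn
  have e : (fun y => f y + g y) = f + g := rfl
  rw [e, iteratedDeriv_add (contDiffAt_of_on hU hx hf hn) (contDiffAt_of_on hU hx hg hn)]
  calc ‖iteratedDeriv n f x + iteratedDeriv n g x‖ ≤ ‖iteratedDeriv n f x‖ + ‖iteratedDeriv n g x‖ := norm_add_le _ _
    _ ≤ C * ρ ^ (m - n) + C' * ρ ^ (m - n) := add_le_add (hF n hn) (hG n hn)
    _ = (C + C') * ρ ^ (m - n) := by ring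

/-- [folklore] **LOCAL SCALAR RULE**: graded `(m, C)` ⟹ `c·f` graded `(m, ‖c‖·C)`. -/
theorem graded_const_mul_on {U : Set ℝ} (hU : IsOpen U) {x : ℝ} (hx : x ∈ U) {m : ℕ} {C ρ : ℝ} {f : ℝ → ℂ} (hf : ContDiffOn ℝ 3 f U)
    (hF : ∀ n ≤ 3, ‖iteratedDeriv n f x‖ ≤ C * ρ ^ (m - n)) (c : ℂ) :
    ∀ n ≤ 3, ‖iteratedDeriv n (fun y => c * f y) x‖ ≤ ‖c‖ * C * ρ ^ (m - n) := by
  intro n hn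
  rw [iteratedDeriv_const_mul c (contDiffAt_of_on hU hx hf hn), norm_mul, mul_assoc]
  exact mul_le_mul_of_nonneg_left (hF n hn) (norm_nonneg _)

/-- [folklore] **LOCAL FINITE SUMS**: every `f i` (`i ∈ s`) `ContDiffOn ℝ 3 · U` and graded `(m, C i)` at `x ∈ U` ⟹ `Σ_{i∈s} f i` graded `(m, Σ C i)`. -/
theorem graded_sum_on {U : Set ℝ} (hU : IsOpen U) {x : ℝ} (hx : x ∈ U) {ι : Type*} (s : Finset ι) {m : ℕ} {C : ι → ℝ} {ρ : ℝ} {f : ι → ℝ → ℂ}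
    (hf : ∀ i ∈ s, ContDiffOn ℝ 3 (f i) U) (hF : ∀ i ∈ s, ∀ n ≤ 3, ‖iteratedDeriv n (f i) x‖ ≤ C i * ρ ^ (m - n)) :
    ∀ n ≤ 3, ‖iteratedDeriv n (fun y => ∑ i ∈ s, f i y) x‖ ≤ (∑ i ∈ s, C i) * ρ ^ (m - n) := by
  classical
  induction s using Finset.induction_on with
  | empty =>
    intro n hn
    simp only [Finset.sum_empty, zero_mul]
    have e : iteratedDeriv n (fun _ : ℝ => (0 : ℂ)) x = 0 := by
      rw [iteratedDeriv_const]; split_ifs <;> rfl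
    rw [e, norm_zero]
  | @insert j s hj ih =>
    have hf' : ∀ i ∈ s, ContDiffOn ℝ 3 (f i) U := fun i hi => hf i (Finset.mem_insert_of_mem hi)
    have hF' : ∀ i ∈ s, ∀ n ≤ 3, ‖iteratedDeriv n (f i) x‖ ≤ C i * ρ ^ (m - n) := fun i hi => hF i (Finset.mem_insert_of_mem hi)
    have hsum : ContDiffOn ℝ 3 (fun y => ∑ i ∈ s, f i y) U := ContDiffOn.sum fun i hi => hf' i hi
    have h := graded_add_on hU hx (hf j (Finset.mem_insert_self j s)) hsum (hF j (Finset.mem_insert_self j s)) (ih hf' hF')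
    have e : (fun y => ∑ i ∈ insert j s, f i y) = fun y => f j y + ∑ i ∈ s, f i y := by
      funext y; rw [Finset.sum_insert hj]
    rw [Finset.sum_insert hj, e]
    exact h

/-- [folklore] a globally `ContDiff ℝ 3` function is `ContDiffOn ℝ 3` on any set (the atoms of `MaxwellSymbolDeriv` qualify). -/
theorem contDiffOn_of_contDiff {f : ℝ → ℂ} (hf : ContDiff ℝ 3 f) (U : Set ℝ) : ContDiffOn ℝ 3 f U := hf.contDiffOn

/-! ## §2 The derivative chain from local regularity -/

/-- [folklore] **THE CHAIN FROM LOCAL REGULARITY**: `ContDiffOn ℝ 3 f U` on an open `U`, `t ∈ U`, `j < 3` ⟹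
`HasDerivAt (iteratedDeriv j f) (iteratedDeriv (j+1) f t) t`. -/
theorem hasDerivAt_iteratedDeriv_on {U : Set ℝ} (hU : IsOpen U) {f : ℝ → ℂ} (hf : ContDiffOn ℝ 3 f U) {j : ℕ} (hj : j < 3) {t : ℝ} (ht : t ∈ U) :
    HasDerivAt (iteratedDeriv j f) (iteratedDeriv (j + 1) f t) t := by
  have hdiffOn : DifferentiableOn ℝ (iteratedDerivWithin j f U) U :=
    hf.differentiableOn_iteratedDerivWithin (by exact_mod_cast hj) hU.uniqueDiffOn
  have hdiffAt : DifferentiableAt ℝ (iteratedDerivWithin j f U) t := (hdiffOn t ht).differentiableAt (hU.mem_nhds ht)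
  -- the within-derivative chain equals the global one near `t`
  have heq : iteratedDerivWithin j f U =ᶠ[𝓝 t] iteratedDeriv j f :=
    Filter.eventuallyEq_of_mem (hU.mem_nhds ht) fun y hy => iteratedDerivWithin_of_isOpen hU hy
  have h1 : HasDerivAt (iteratedDeriv j f) (deriv (iteratedDerivWithin j f U) t) t :=
    hdiffAt.hasDerivAt.congr_of_eventuallyEq heq.symm
  have hval : deriv (iteratedDerivWithin j f U) t = iteratedDeriv (j + 1) f t := by
    rw [← iteratedDerivWithin_of_isOpen hU ht, iteratedDerivWithin_succ, derivWithin_of_isOpen hU ht]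
  rw [hval] at h1
  exact h1

end Summit.QuantumFields.BalabanUV.Beta.FP.GradedIteratedDerivOn

end
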